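import Summits.Ventures.DiscreteObjects.Hadamard.PAFParityTools
import Summits.Ventures.DiscreteObjects.Hadamard.Order333Centralizer668

/-!
# H(668): an automorphism INVERTING an element of order 333 swaps its two orbits on both sides (kernel) — no 'dihedral symmetry
# within the cores' of an LP(333)-type Hadamard matrix

Framing: lottery ticket; floor = certified bounds/negative ranges.

Cell pub-namedobj (venture DiscreteObjects), target (H), hadamard gen 19.  Let `σ = (π, κ, d, e)` be a signed automorphism of a
Hadamard matrix of order `668` of pair order `333` (two fixed points and two regular orbits on each side, gen 19), and `τ` a signed
automorphism whose permutation pair INVERTS that of `σ`: `π'π = π⁻¹π'`, `κ'κ = κ⁻¹κ'` (the non-trivial coset of the dihedral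
normaliser).  Then **`τ` maps every `σ`-free row OUT of its own `σ`-orbit** (and likewise every free column):
`hadamard668_order333_inverting_swaps_orbits`.  Equivalently: no H(668) with an element of order 333 has a reflecting automorphism
that preserves one of the two cores.  Proof.  Re-sign so that `σ` is a permutation pair; the signs of `τ` are then constant along
`σ`-orbits (compare `H'(π'πx, κ'κy)` two ways, using a fixed column / row).  If `π' x₀ = π^c x₀` for a free row `x₀`, read the
Legendre pair `(a, b)` of `x₀` along the two column orbits (`CyclicCorePAF`): the relation `H'(π'x₀, κ'j) = ± H'(x₀, j)` becomes
either (A) `a(C − t) = η a(t)` and `b(C' − t) = η' b(t)` — then `η = η' = 1` and suitable translates are SYMMETRIC, contradicting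
RHdQ Proposition 1 (`no_symmetric_legendrePair333`, Literature) — or (B) `b(C − t) = η a(t)` (the column orbits are exchanged) —
then `PAF_a = PAF_b = −1`, contradicting `PAF ≡ 333 (mod 4)` (`PAFParityTools`).  So, with `Order333Centralizer668`: the normaliser
of `⟨σ⟩` meets the cores only through `⟨σ⟩` itself and through core-EXCHANGING reflections (as the two-circulant-core matrix of a
Legendre pair indeed has: 'swap the cores and reverse').  Structure of a hypothetical object; H(668) untouched.  Ours (the Legendre-
pair input is RHdQ 2026 Prop. 1, replication side); no `sorry`, no definitions.
-/

namespace Summit.Ventures.DiscreteObjects.Hadamard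

open Finset BigOperators Matrix

open Literature.Combinatorics.Designs.GoethalsSeidel (IsHadamardMatrix)
open Literature.Combinatorics.Designs.LegendrePairs (PAF IsPM LegendrePair legendrePair_translate)
open Literature.Combinatorics.Designs.LegendrePairs.NineComp333 (no_symmetric_legendrePair333)

variable {ι : Type*} [Fintype ι] [DecidableEq ι]

/-! ### permutations inverting a permutation with `π^333 = 1` -/

section inverting
variable {π ψ : Equiv.Perm ι} (hi : ψ * π = π⁻¹ * ψ)
include hi

omit [Fintype ι] [DecidableEq ι] in
/-- `ψ π^k = (π⁻¹)^k ψ` -/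
lemma inv_comm_pow (k : ℕ) : ψ * π ^ k = π⁻¹ ^ k * ψ := by
  induction k with
  | zero => simp
  | succ k ih => rw [pow_succ, ← mul_assoc, ih, mul_assoc, hi, ← mul_assoc, ← pow_succ]

omit [Fintype ι] [DecidableEq ι] in
/-- with `π^333 = 1`: `ψ (π^k x) = π^(332 k) (ψ x)` -/
lemma inv_apply_pow (hπ : π ^ 333 = 1) (k : ℕ) (x : ι) : ψ ((π ^ k) x) = (π ^ (332 * k)) (ψ x) := by
  have hinv : π⁻¹ = π ^ 332 := inv_eq_of_mul_eq_one_right (by rw [← pow_succ', hπ])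
  have h := congrArg (fun ρ : Equiv.Perm ι => ρ x) (inv_comm_pow hi k)
  simp only [Equiv.Perm.mul_apply] at h
  rw [h, hinv, ← pow_mul]

omit [Fintype ι] [DecidableEq ι] in
/-- an inverting permutation maps moved points to moved points -/
lemma inv_moved {y : ι} (hy : π y ≠ y) : π (ψ y) ≠ ψ y := by
  intro hfix
  have h1 : ψ (π y) = π⁻¹ (ψ y) := by
    have := congrArg (fun ρ : Equiv.Perm ι => ρ y) hi; simpa using this
  have h2 : π⁻¹ (ψ y) = ψ y := Equiv.Perm.inv_eq_iff_eq.mpr hfix.symm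
  rw [h2] at h1
  exact hy (ψ.injective h1)

end inverting

omit [Fintype ι] [DecidableEq ι] in
/-- powers of `κ` with congruent exponents mod `333` agree -/
lemma pow_eq_pow_of_natCast_eq {κ : Equiv.Perm ι} (hκ : κ ^ 333 = 1) {m m' : ℕ}
    (h : (m : ZMod 333) = (m' : ZMod 333)) : κ ^ m = κ ^ m' := by
  rw [ZMod.natCast_eq_natCast_iff'] at h
  rw [← pow_mod_of_pow_eq_one κ hκ m, ← pow_mod_of_pow_eq_one κ hκ m', h]

section main
variable {H : Matrix ι ι ℤ}

/-- **rows**: an inverting automorphism maps a free row out of its `σ`-orbit -/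
theorem inverting_not_mem_orbit_row (hH : IsHadamardMatrix H) (hι : Fintype.card ι = 668)
    {π κ π' κ' : Equiv.Perm ι} {d e d' e' : ι → ℤ} (haut : IsSignedAut H π κ d e)
    (hπ : π ^ 333 = 1) (hκ : κ ^ 333 = 1) (h111 : π ^ 111 ≠ 1 ∨ κ ^ 111 ≠ 1) (h9 : π ^ 9 ≠ 1 ∨ κ ^ 9 ≠ 1)
    (haut' : IsSignedAut H π' κ' d' e') (hiπ : π' * π = π⁻¹ * π') (hiκ : κ' * κ = κ⁻¹ * κ')
    {x₀ : ι} (hx₀ : π x₀ ≠ x₀) : π' x₀ ∉ orbFin π 333 x₀ := by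
  intro hmem
  obtain ⟨⟨hR2, hRfree⟩, hC2, hCfree⟩ := hadamard668_order333_orbitType hH hι π κ d e haut hπ hκ h111 h9
  -- re-sign: σ becomes a permutation pair of H'
  obtain ⟨s, t, hs, ht, hH', hinv⟩ := exists_resign_of_odd hH haut (by decide : Odd 333) hπ hκ
  set H' : Matrix ι ι ℤ := Matrix.of fun i j => s i * t j * H i j with hH'def
  have hinv' : ∀ i j, H' (π i) (κ j) = H' i j := fun i j => by simp only [hH'def, Matrix.of_apply]; exact hinv i j
  have hinvm : ∀ m i j, H' ((π ^ m) i) ((κ ^ m) j) = H' i j := perm_aut_pow hinv'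
  -- τ on H'
  set d₁ : ι → ℤ := fun i => s (π' i) * s i * d' i with hd₁
  set e₁ : ι → ℤ := fun j => t (κ' j) * t j * e' j with he₁
  have hτ : ∀ i j, H' (π' i) (κ' j) = d₁ i * e₁ j * H' i j := by
    intro i j
    simp only [hH'def, Matrix.of_apply, hd₁, he₁]
    rw [haut'.2.2 i j]
    have h1 := pm_mul_self (hs i); have h2 := pm_mul_self (ht j)
    calc s (π' i) * t (κ' j) * (d' i * e' j * H i j)
        = s (π' i) * t (κ' j) * (d' i * e' j * H i j) * ((s i * s i) * (t j * t j)) := by rw [h1, h2]; ring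
      _ = s (π' i) * s i * d' i * (t (κ' j) * t j * e' j) * (s i * t j * H i j) := by ring
  have hd₁pm : ∀ i, d₁ i = 1 ∨ d₁ i = -1 := fun i => by
    rcases hs (π' i) with h1 | h1 <;> rcases hs i with h2 | h2 <;> rcases haut'.1 i with h3 | h3 <;> simp [hd₁, h1, h2, h3]
  have he₁pm : ∀ j, e₁ j = 1 ∨ e₁ j = -1 := fun j => by
    rcases ht (κ' j) with h1 | h1 <;> rcases ht j with h2 | h2 <;> rcases haut'.2.1 j with h3 | h3 <;> simp [he₁, h1, h2, h3]
  have hH'ne : ∀ i j, H' i j ≠ 0 := fun i j => pm_ne_zero (hH'.1 i j)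
  -- sign constancy along σ-orbits
  have key : ∀ x y, d₁ (π x) * e₁ (κ y) * H' x y = d₁ x * e₁ y * H' x y := by
    intro x y
    have h1 : H' (π' (π x)) (κ' (κ y)) = d₁ (π x) * e₁ (κ y) * H' x y := by rw [hτ, hinv']
    have h2 : π' (π x) = π⁻¹ (π' x) := by
      have := congrArg (fun ρ : Equiv.Perm ι => ρ x) hiπ; simpa using this
    have h3 : κ' (κ y) = κ⁻¹ (κ' y) := by
      have := congrArg (fun ρ : Equiv.Perm ι => ρ y) hiκ; simpa using this
    have h4 : H' (π⁻¹ (π' x)) (κ⁻¹ (κ' y)) = H' (π' x) (κ' y) := by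
      have e1 : π (π⁻¹ (π' x)) = π' x := by rw [← Equiv.Perm.mul_apply, mul_inv_cancel, Equiv.Perm.one_apply]
      have e2 : κ (κ⁻¹ (κ' y)) = κ' y := by rw [← Equiv.Perm.mul_apply, mul_inv_cancel, Equiv.Perm.one_apply]
      have := hinv' (π⁻¹ (π' x)) (κ⁻¹ (κ' y))
      rw [e1, e2] at this
      exact this.symm
    rw [h2, h3, h4, hτ] at h1
    exact h1.symm
  obtain ⟨w, hw⟩ : ∃ w, κ w = w := by
    obtain ⟨w, hw⟩ := Finset.card_pos.mp (by rw [hC2]; norm_num : 0 < (univ.filter fun j => κ j = j).card)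
    exact ⟨w, (Finset.mem_filter.mp hw).2⟩
  obtain ⟨u, hu⟩ : ∃ u, π u = u := by
    obtain ⟨u, hu⟩ := Finset.card_pos.mp (by rw [hR2]; norm_num : 0 < (univ.filter fun i => π i = i).card)
    exact ⟨u, (Finset.mem_filter.mp hu).2⟩
  have hdπ : ∀ x, d₁ (π x) = d₁ x := by
    intro x
    have h := key x w
    rw [hw] at h
    have hne : e₁ w * H' x w ≠ 0 := mul_ne_zero (pm_ne_zero (he₁pm w)) (hH'ne x w)
    have : (d₁ (π x) - d₁ x) * (e₁ w * H' x w) = 0 := by linarith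
    rcases mul_eq_zero.mp this with h0 | h0
    · linarith
    · exact (hne h0).elim
  have heκ : ∀ y, e₁ (κ y) = e₁ y := by
    intro y
    have h := key u y
    rw [hu] at h
    have hne : d₁ u * H' u y ≠ 0 := mul_ne_zero (pm_ne_zero (hd₁pm u)) (hH'ne u y)
    have : (e₁ (κ y) - e₁ y) * (d₁ u * H' u y) = 0 := by linarith
    rcases mul_eq_zero.mp this with h0 | h0
    · linarith
    · exact (hne h0).elim
  have heκpow : ∀ k y, e₁ ((κ ^ k) y) = e₁ y := by
    intro k; induction k with
    | zero => intro y; simp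
    | succ k ih => intro y; rw [pow_succ', Equiv.Perm.mul_apply, heκ, ih]
  -- π' x₀ = π^c x₀
  obtain ⟨c, -, hc⟩ := Finset.mem_image.mp hmem
  -- the column transversal {y₃, y₄} and the Legendre pair of x₀
  have hstab : ∀ y ∈ univ.filter (fun y => κ y ≠ y), κ y ∈ univ.filter (fun y => κ y ≠ y) := by
    intro y hy; rw [Finset.mem_filter] at hy ⊢; exact ⟨Finset.mem_univ _, fun h => hy.2 (κ.injective h)⟩
  obtain ⟨T, hTsub, hTc, hT⟩ := exists_free_transversal κ (by norm_num : 0 < 333) _ (univ.filter fun y => κ y ≠ y) le_rfl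
    hstab (fun y _ => by rw [hκ, Equiv.Perm.one_apply]) (fun y hy => hCfree y (Finset.mem_filter.mp hy).2)
  have hsplit := Finset.card_filter_add_card_filter_not (s := (univ : Finset ι)) (fun y => κ y = y)
  rw [hC2, Finset.card_univ, hι] at hsplit
  have hm666 : (univ.filter fun y => ¬ κ y = y).card = 666 := by omega
  have hm666' : (univ.filter fun y => κ y ≠ y).card = 666 := hm666
  rw [hm666'] at hTc
  obtain ⟨y₃, y₄, hne34, hT34⟩ := Finset.card_eq_two.mp (by omega : T.card = 2)
  have hy₃T : y₃ ∈ T := by rw [hT34]; simp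
  have hy₄T : y₄ ∈ T := by rw [hT34]; simp
  have hx₀free : ∀ k, 0 < k → k < 333 → (π ^ k) x₀ ≠ x₀ := hRfree x₀ hx₀
  -- the Legendre pair (a, b)
  set a : ZMod 333 → ℤ := fun r => H' x₀ ((κ ^ r.val) y₃) with ha
  set b : ZMod 333 → ℤ := fun r => H' x₀ ((κ ^ r.val) y₄) with hb
  have hpafa : ∀ z : ZMod 333, PAF a z = ∑ k ∈ Finset.range 333, H' x₀ ((κ ^ k) y₃) * H' x₀ ((κ ^ (k + z.val)) y₃) := by
    intro z
    unfold PAF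
    have hterm : ∀ r : ZMod 333, a r * a (r + z) = H' x₀ ((κ ^ r.val) y₃) * H' x₀ ((κ ^ (r.val + z.val)) y₃) := by
      intro r; simp only [ha]; rw [ZMod.val_add, pow_mod_of_pow_eq_one κ hκ]
    simp only [hterm]
    exact sum_zmod_val_eq_sum_range (fun k => H' x₀ ((κ ^ k) y₃) * H' x₀ ((κ ^ (k + z.val)) y₃))
  have hpafb : ∀ z : ZMod 333, PAF b z = ∑ k ∈ Finset.range 333, H' x₀ ((κ ^ k) y₄) * H' x₀ ((κ ^ (k + z.val)) y₄) := by
    intro z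
    unfold PAF
    have hterm : ∀ r : ZMod 333, b r * b (r + z) = H' x₀ ((κ ^ r.val) y₄) * H' x₀ ((κ ^ (r.val + z.val)) y₄) := by
      intro r; simp only [hb]; rw [ZMod.val_add, pow_mod_of_pow_eq_one κ hκ]
    simp only [hterm]
    exact sum_zmod_val_eq_sum_range (fun k => H' x₀ ((κ ^ k) y₄) * H' x₀ ((κ ^ (k + z.val)) y₄))
  have hL : LegendrePair a b := by
    refine ⟨fun r => hH'.1 _ _, fun r => hH'.1 _ _, fun z hz => ?_⟩
    obtain ⟨hz0, hzn⟩ := zmod_val_pos_of_ne_zero hz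
    have hid := cyclicCore_paf_identity hH' hinv' hπ T hT hx₀free hz0 hzn
    rw [hT34, Finset.sum_pair hne34, hC2] at hid
    rw [hpafa, hpafb]
    exact_mod_cast hid
  -- the relation between τ and the sequences: H'(π' x₀, κ' (κ^k y₃)) two ways
  -- the fundamental relation along the cycle of y ∈ {y₃, y₄}: τ reflects the sequences
  have hrel : ∀ (y r : ι) (j : ℕ), κ' y = (κ ^ j) r → ∀ k : ℕ,
      H' x₀ ((κ ^ (332 * k + j + 332 * c)) r) = d₁ x₀ * e₁ y * H' x₀ ((κ ^ k) y) := by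
    intro y r j hyr k
    have h1 := hτ x₀ ((κ ^ k) y)
    rw [heκpow, ← hc, inv_apply_pow hiκ hκ k y, hyr, ← Equiv.Perm.mul_apply, ← pow_add] at h1
    -- H'((π^c) x₀, (κ^(332k+j)) r) = H'(x₀, (κ^(332k+j+332c)) r)
    have h2 : H' ((π ^ c) x₀) ((κ ^ (332 * k + j)) r) = H' x₀ ((κ ^ (332 * k + j + 332 * c)) r) := by
      have e : κ ^ (332 * k + j) = κ ^ c * κ ^ (332 * k + j + 332 * c) := by
        rw [← pow_add]
        apply pow_eq_pow_of_natCast_eq hκ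
        have h333 : (333 : ZMod 333) = 0 := by decide
        push_cast
        linear_combination (-(c : ZMod 333)) * h333
      rw [e, Equiv.Perm.mul_apply, hinvm]
    rw [← h2, h1]
  -- reflection in `ZMod 333` language
  have hreflect : ∀ (y r : ι) (j : ℕ), κ' y = (κ ^ j) r → ∀ tt : ZMod 333,
      H' x₀ ((κ ^ (((j : ZMod 333) + 332 * (c : ZMod 333)) - tt).val) r) =
        d₁ x₀ * e₁ y * H' x₀ ((κ ^ tt.val) y) := by
    intro y r j hyr tt
    rw [← hrel y r j hyr tt.val]
    congr 2
    apply pow_eq_pow_of_natCast_eq hκ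
    have h332 : (332 : ZMod 333) = -1 := by decide
    rw [ZMod.natCast_zmod_val]
    push_cast
    rw [ZMod.natCast_zmod_val, h332]
    ring
  have hηpm : ∀ y, d₁ x₀ * e₁ y = 1 ∨ d₁ x₀ * e₁ y = -1 := fun y => by
    rcases hd₁pm x₀ with h1 | h1 <;> rcases he₁pm y with h2 | h2 <;> simp [h1, h2]
  -- where does κ' send y₃ and y₄?
  have hmv3 : κ (κ' y₃) ≠ κ' y₃ := inv_moved hiκ (Finset.mem_filter.mp (hTsub hy₃T)).2
  have hmv4 : κ (κ' y₄) ≠ κ' y₄ := inv_moved hiκ (Finset.mem_filter.mp (hTsub hy₄T)).2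
  obtain ⟨r₃, hr₃T, j₃, hj₃, hrj₃⟩ := exists_rep_of_moved T hT hmv3
  obtain ⟨r₄, hr₄T, j₄, hj₄, hrj₄⟩ := exists_rep_of_moved T hT hmv4
  have mem2 : ∀ r ∈ T, r = y₃ ∨ r = y₄ := fun r hr => by simpa [hT34] using hr
  -- the two images lie in different orbits
  have hdiff : r₃ ≠ r₄ := by
    intro heq
    subst heq
    -- κ' (κ^m y₃) = κ' y₄ for a suitable m, so y₄ lies on the cycle of y₃
    obtain ⟨m, hm⟩ : ∃ m : ℕ, ((332 * m + j₃ : ℕ) : ZMod 333) = ((j₄ : ℕ) : ZMod 333) := by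
      refine ⟨j₃ + 333 - j₄ % 333, ?_⟩
      have h332 : (332 : ZMod 333) = -1 := by decide
      have h333 : ((333 : ℕ) : ZMod 333) = 0 := by decide
      rw [Nat.cast_add, Nat.cast_mul, Nat.cast_sub (by omega), Nat.cast_add, ZMod.natCast_mod, h333]
      push_cast
      rw [h332]; ring
    have h1 : κ' ((κ ^ m) y₃) = κ' y₄ := by
      rw [inv_apply_pow hiκ hκ m y₃, ← hrj₃, ← Equiv.Perm.mul_apply, ← pow_add, pow_eq_pow_of_natCast_eq hκ hm, hrj₄]
    have h2 : (κ ^ (m % 333)) y₃ = (κ ^ 0) y₄ := by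
      rw [pow_mod_of_pow_eq_one κ hκ, pow_zero, Equiv.Perm.one_apply]; exact κ'.injective h1
    obtain ⟨h3, -⟩ := orbitMap_unique κ T (univ.filter fun y => κ y ≠ y) hT hy₃T hy₄T (Nat.mod_lt _ (by norm_num))
      (by norm_num) (by rw [h2, pow_zero, Equiv.Perm.one_apply]; exact hTsub hy₄T) h2
    exact hne34 h3
  rcases mem2 r₃ hr₃T with h3 | h3
  · -- Case A: κ' preserves both column orbits; both sequences are reflected into themselves
    rw [h3] at hrj₃ hdiff
    have h4 : r₄ = y₄ := by
      rcases mem2 r₄ hr₄T with h | h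
      · exact (hdiff h.symm).elim
      · exact h
    rw [h4] at hrj₄
    have hA : ∀ tt : ZMod 333, a (((j₃ : ZMod 333) + 332 * (c : ZMod 333)) - tt) = (d₁ x₀ * e₁ y₃) * a tt :=
      fun tt => hreflect y₃ y₃ j₃ hrj₃.symm tt
    have hB : ∀ tt : ZMod 333, b (((j₄ : ZMod 333) + 332 * (c : ZMod 333)) - tt) = (d₁ x₀ * e₁ y₄) * b tt :=
      fun tt => hreflect y₄ y₄ j₄ hrj₄.symm tt
    have hηa := eta_eq_one_of_reflect a hL.1 (hηpm y₃) _ hA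
    have hηb := eta_eq_one_of_reflect b hL.2.1 (hηpm y₄) _ hB
    rw [hηa] at hA; rw [hηb] at hB
    simp only [one_mul] at hA hB
    have hsa := symmetric_translate_of_reflect a _ hA
    have hsb := symmetric_translate_of_reflect b _ hB
    exact no_symmetric_legendrePair333 _ _ (legendrePair_translate a b hL _ _) hsa hsb
  · -- Case B: κ' exchanges the column orbits; b is a reflected copy of a
    rw [h3] at hrj₃
    have hB : ∀ tt : ZMod 333, b (((j₃ : ZMod 333) + 332 * (c : ZMod 333)) - tt) = (d₁ x₀ * e₁ y₃) * a tt :=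
      fun tt => hreflect y₃ y₄ j₃ hrj₃.symm tt
    have hpaf := paf_eq_of_reflect a b (hηpm y₃) _ hB (1 : ZMod 333)
    exact legendrePair333_paf_ne a b hL (by decide) hpaf

/-- **An automorphism inverting an element of order 333 swaps its orbits, on rows and on columns.** -/
theorem hadamard668_order333_inverting_swaps_orbits (hH : IsHadamardMatrix H) (hι : Fintype.card ι = 668)
    {π κ π' κ' : Equiv.Perm ι} {d e d' e' : ι → ℤ} (haut : IsSignedAut H π κ d e)
    (hπ : π ^ 333 = 1) (hκ : κ ^ 333 = 1) (h111 : π ^ 111 ≠ 1 ∨ κ ^ 111 ≠ 1) (h9 : π ^ 9 ≠ 1 ∨ κ ^ 9 ≠ 1)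
    (haut' : IsSignedAut H π' κ' d' e') (hiπ : π' * π = π⁻¹ * π') (hiκ : κ' * κ = κ⁻¹ * κ') :
    (∀ x, π x ≠ x → π' x ∉ orbFin π 333 x) ∧ (∀ y, κ y ≠ y → κ' y ∉ orbFin κ 333 y) := by
  have hcard : (Fintype.card ι : ℤ) ≠ 0 := by rw [hι]; norm_num
  exact ⟨fun x hx => inverting_not_mem_orbit_row hH hι haut hπ hκ h111 h9 haut' hiπ hiκ hx,
    fun y hy => inverting_not_mem_orbit_row (isHadamard_transpose hH hcard) hι (isSignedAut_transpose haut) hκ hπ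
      h111.symm h9.symm (isSignedAut_transpose haut') hiκ hiπ hy⟩

end main

end Summit.Ventures.DiscreteObjects.Hadamard
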